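import Mathlib.GroupTheory.OrderOfElement
import Literature.AlgebraicGeometry.Frobenioids.ModelFrobenioidFunctor
import Literature.AlgebraicGeometry.Frobenioids.PreFrobenioidMorphisms
import Literature.AnabelianGeometry.EtaleTheta.TemperedFrobenioid

/-!
# [EtTh] Definition 3.6 (ii), conclusion: "the data `(D, Φ, B, B → Φ^gp)` determines a model
# Frobenioid `C` [cf. [FrdI], Theorem 5.2, (ii)]" — the category of a tempered Frobenioid

Source: [MochizukiEtTh2009] §3, Definition 3.6 (ii), PDF p.77 (printed 303). This file performs the
merge announced in `TemperedFrobenioid.lean` (TODO-merge(abc-iut-L1-t2), now landed as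
`Literature/AlgebraicGeometry/Frobenioids/ModelFrobenioid.lean`, [FrdI] Thm 5.2 (i)): from a
tempered Frobenioid structure `C` (Def 3.6 (ii)) it packages

* the rational-function monoid `B := B₀^Λ|_D ×_{(Φ^{ℝ-log})^gp} Φ^gp` as a monoid on `D`
  (`ratFnFunctor : Dᵒᵖ ⥤ CommMonCat`, pull-backs acting on both components),
* `Div_B : B → Φ^gp` as a natural transformation to `monoidGp Φ` (`divBNatTrans`), and
* **the Frobenioid `C` itself**: `TemperedFrobenioid.category := Frobenioids.ModelFrobenioid Φ B Div_B`,
  a category (objects `(A_D, α ∈ Φ(A_D)^gp)`, morphisms `(deg_Fr, Base, Div, u)`), with its projection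
  `Base : C → D`.

That this category is a *Frobenioid* (of isotropic, model, … type) is [FrdI] Thm 5.2 (ii)–(iv) and
[EtTh] Thm 3.7 — statements over the Def 1.2–1.3 vocabulary, not asserted here.
-/

namespace Literature.AnabelianGeometry.EtaleTheta

open CategoryTheory Opposite Literature.AlgebraicGeometry.Frobenioids

universe u₀ v₀ u v w

namespace TemperedFrobenioid

variable {D₀ : Type u₀} [Category.{v₀} D₀] {V : FrdIMonoidStub.{w}}
  {T : RealifiedDivisorMonoids (D₀ := D₀) V} {D : Type u} [Category.{v} D]
  {VD : FrdICatStub.{u, v, w} D} (C : TemperedFrobenioid T D VD)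

/-- Groupification homomorphisms out of `M^gp` are determined on `M`. [folklore] -/
private theorem gp_hom_ext {M N : Type w} [CommMonoid M] [CommGroup N]
    {f₁ f₂ : Algebra.GrothendieckGroup M →* N}
    (h : ∀ m : M, f₁ (Algebra.GrothendieckGroup.of m) = f₂ (Algebra.GrothendieckGroup.of m)) :
    f₁ = f₂ := by
  apply Algebra.GrothendieckGroup.lift.symm.injective
  rw [Algebra.GrothendieckGroup.lift_symm_apply, Algebra.GrothendieckGroup.lift_symm_apply]
  exact MonoidHom.ext h

/-- `gpMap` of (a homomorphism equal to) the identity is the identity. [folklore] -/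
private theorem gpMap_eq_id {M : Type w} [CommMonoid M] {f : M →* M} (hf : ∀ x, f x = x)
    (ξ : Algebra.GrothendieckGroup M) : gpMap f ξ = ξ := by
  have : gpMap f = MonoidHom.id _ := gp_hom_ext fun m => by rw [gpMap_of, hf]; rfl
  rw [this, MonoidHom.id_apply]

/-- `gpMap` is compatible with composition, pointwise. [folklore] -/
private theorem gpMap_comp_apply {M N P : Type w} [CommMonoid M] [CommMonoid N] [CommMonoid P]
    (f : M →* N) (g : N →* P) (h : M →* P) (hfg : ∀ x, g (f x) = h x)
    (ξ : Algebra.GrothendieckGroup M) : gpMap g (gpMap f ξ) = gpMap h ξ := by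
  have : (gpMap g).comp (gpMap f) = gpMap h := gp_hom_ext fun m => by
    rw [MonoidHom.comp_apply, gpMap_of, gpMap_of, gpMap_of, hfg]
  rw [← MonoidHom.comp_apply, this]

/-- Naturality of the inclusions `Φ(A)^gp → (Φ^{ℝ-log})^gp(A)` with respect to pull-back.
[cite: MochizukiEtTh2009, Def 3.6 p.77] -/
theorem ΦgpToRlog_pull {A A' : Dᵒᵖ} (f : A ⟶ A') (ξ : Algebra.GrothendieckGroup (C.Φ.carrier A)) :
    C.ΦgpToRlog A' (gpMap (C.Φ.pull f) ξ) =
      gpMap (T.ΦR.map (C.base.map f.unop).op).hom (C.ΦgpToRlog A ξ) := by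
  have key : (C.ΦgpToRlog A').comp (gpMap (C.Φ.pull f)) =
      (gpMap (T.ΦR.map (C.base.map f.unop).op).hom).comp (C.ΦgpToRlog A) :=
    gp_hom_ext fun x =>
      ((congrArg (C.ΦgpToRlog A') (gpMap_of (C.Φ.pull f) x)).trans
        (gpMap_of (C.Φ.carrier A').subtype (C.Φ.pull f x))).trans
      (((congrArg (gpMap (T.ΦR.map (C.base.map f.unop).op).hom)
        (gpMap_of (C.Φ.carrier A).subtype x)).trans
        (gpMap_of (T.ΦR.map (C.base.map f.unop).op).hom (x : (C.base.op ⋙ T.ΦR).obj A))).symm)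
  exact DFunLike.congr_fun key ξ

/-- Pull-back on the rational-function monoid `B = B₀^Λ|_D ×_{(Φ^{ℝ-log})^gp} Φ^gp`: componentwise
(`B₀^Λ(Base f)`, `Φ(f)^gp`); it preserves the fibre-product condition by the naturality of
`B₀^Λ → (Φ₀^ℝ)^gp` (Def 3.6 (i) data) and of `Φ^gp → (Φ^{ℝ-log})^gp`. [cite: MochizukiEtTh2009, Def 3.6 p.77] -/
noncomputable def ratFnPull {A A' : Dᵒᵖ} (f : A ⟶ A') : C.ratFn A →* C.ratFn A' :=
  (((T.BΛ.map (C.base.map f.unop).op).hom.prodMap (gpMap (C.Φ.pull f))).restrict (C.ratFn A)).codRestrict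
    (C.ratFn A') fun p => by
      change T.divΛ (C.baseOp A') ((T.BΛ.map (C.base.map f.unop).op).hom p.1.1) =
        C.ΦgpToRlog A' (gpMap (C.Φ.pull f) p.1.2)
      rw [T.divΛ_natural, C.ΦgpToRlog_pull, p.2]

/-- Components of `ratFnPull`. [cite: MochizukiEtTh2009, Def 3.6 p.77] -/
@[simp] theorem coe_ratFnPull {A A' : Dᵒᵖ} (f : A ⟶ A') (p : C.ratFn A) :
    ((C.ratFnPull f p : C.ratFn A') : (T.BΛ.obj (C.baseOp A') : Type w) × _) =
      ((T.BΛ.map (C.base.map f.unop).op).hom p.1.1, gpMap (C.Φ.pull f) p.1.2) := rfl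

/-- `B` as a monoid on `D`: the functor `Dᵒᵖ ⥤ CommMonCat` of the data `(D, Φ, B, B → Φ^gp)` (p.77).
[cite: MochizukiEtTh2009, Def 3.6 p.77] -/
noncomputable def ratFnFunctor : Dᵒᵖ ⥤ CommMonCat.{w} where
  obj A := CommMonCat.of (C.ratFn A)
  map f := CommMonCat.ofHom (C.ratFnPull f)
  map_id A := by
    apply CommMonCat.hom_ext
    ext p
    · change (T.BΛ.map (C.base.map (𝟙 (unop A))).op).hom p.1.1 = p.1.1
      rw [C.base.map_id, op_id, T.BΛ.map_id]
      rfl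
    · change gpMap (C.Φ.pull (𝟙 A)) p.1.2 = p.1.2
      exact gpMap_eq_id (fun x => Subtype.ext
        ((congrArg (fun φ => CommMonCat.Hom.hom φ x.1) ((C.base.op ⋙ T.ΦR).map_id A)).trans rfl)) _
  map_comp {A A' A''} f g := by
    apply CommMonCat.hom_ext
    ext p
    · change (T.BΛ.map (C.base.map (f ≫ g).unop).op).hom p.1.1 =
        (T.BΛ.map (C.base.map g.unop).op).hom ((T.BΛ.map (C.base.map f.unop).op).hom p.1.1)
      rw [unop_comp, C.base.map_comp, op_comp, T.BΛ.map_comp]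
      rfl
    · change gpMap (C.Φ.pull (f ≫ g)) p.1.2 = gpMap (C.Φ.pull g) (gpMap (C.Φ.pull f) p.1.2)
      exact (gpMap_comp_apply _ _ _ (fun x => Subtype.ext
        (congrArg (fun φ => CommMonCat.Hom.hom φ x.1) ((C.base.op ⋙ T.ΦR).map_comp f g)).symm) _).symm

/-- `Div_B : B → Φ^gp` as a homomorphism of monoids on `D` (a natural transformation to
`monoidGp Φ`, [FrdI] Thm 5.2 preamble). [cite: MochizukiEtTh2009, Def 3.6 p.77] -/
noncomputable def divBNatTrans : C.ratFnFunctor ⟶ monoidGp C.divisorMonoid where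
  app A := CommMonCat.ofHom (C.divB A)
  naturality {A A'} f := by
    apply CommMonCat.hom_ext
    ext p
    change gpMap (C.Φ.pull f) p.1.2 = MonGp.map (C.Φ.pull f) p.1.2
    rfl

/-- **The tempered Frobenioid as a category**: "the data `(D, Φ, B, B → Φ^gp)` determines a model
Frobenioid `C` [cf. [FrdI], Theorem 5.2, (ii)]. We shall refer to a Frobenioid `C` obtained in this
way as a *tempered Frobenioid*" (Def 3.6 (ii), p.77) — here the model-Frobenioid category of [FrdI]
Thm 5.2 (i) (`Frobenioids.ModelFrobenioid`) on this data. [cite: MochizukiEtTh2009, Def 3.6 p.77] -/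
noncomputable abbrev category : Type (max u w) :=
  ModelFrobenioid C.divisorMonoid C.ratFnFunctor C.divBNatTrans

/-- The projection `Base : C → D` of the tempered Frobenioid ([FrdI] Thm 5.2 (i)).
[cite: MochizukiEtTh2009, Def 3.6 p.77] -/
noncomputable abbrev baseFunctorOfCategory : C.category ⥤ D :=
  ModelFrobenioid.baseFunctor C.divisorMonoid C.ratFnFunctor C.divBNatTrans

/-- The pre-Frobenioid structure `C → F_Φ` of the tempered Frobenioid ("the Frobenius degree,
projection to `D`, and zero divisor", [FrdI] Thm 5.2 (i); tree `ModelFrobenioid.toElem`) — through it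
all the notions of [FrdI] Def 1.2 (`Frobenioids.PreFrobenioid.IsPreStep`, `unitsSubgroup`, …) apply to
`C`. [cite: MochizukiEtTh2009, Def 3.6 p.77] -/
noncomputable abbrev toElem : C.category ⥤ ElemFrobenioid C.divisorMonoid :=
  ModelFrobenioid.toElem C.divisorMonoid C.ratFnFunctor C.divBNatTrans

/-- `O^×(A) ⊆ Aut_C(A)` for an object of the tempered Frobenioid ([FrdI] Def 1.2 (ii), via the tree's
`PreFrobenioid.unitsSubgroup`). [cite: MochizukiEtTh2009, Thm 3.7 p.79] -/
noncomputable abbrev units (A : C.category) : Subgroup (Aut A) := PreFrobenioid.unitsSubgroup C.toElem A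

/-- `μ_N(A) ⊆ O^×(A)`: "the subgroup of elements of `O^×(A)` that are annihilated by `N`" ([FrdII]
Def 2.1 (i), kurims p.16), as a subset of `Aut_C(A)` (a subgroup once `O^×(A)` is known to be
commutative, [FrdI] Rmk 1.3.1). [cite: MochizukiEtTh2009, Def 4.1 p.87] -/
def mu (A : C.category) (N : ℕ+) : Set (Aut A) := {σ | σ ∈ C.units A ∧ σ ^ (N : ℕ) = 1}

/-- "`A` is `μ_N`-*saturated* if the abstract group `μ_N(A)` is isomorphic to `ℤ/Nℤ`" ([FrdII] Def 2.1
(i), kurims p.16): `μ_N(A)` is generated by an element of order `N`. [cite: MochizukiEtTh2009, Def 4.1 p.87] -/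
def IsMuSaturated (A : C.category) (N : ℕ+) : Prop :=
  ∃ σ ∈ C.mu A N, orderOf σ = (N : ℕ) ∧ ∀ τ ∈ C.mu A N, τ ∈ Subgroup.zpowers σ

/-- The groupified divisor monoid `(Φ^{bs-fld})^gp` of the *base-field-theoretic hull* (Def 3.6 (iv),
p.78: the target of `F → (Φ^{bs-fld})^gp` in the data `(D, Φ^{bs-fld}, F, F → (Φ^{bs-fld})^gp)` of
`C^{bs-fld}`; the hull's rational-function side and its identification with a `p`-adic Frobenioid are
TODO-merge(abc-iut-L1-t4)). [cite: MochizukiEtTh2009, Def 3.6 p.78] -/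
noncomputable abbrev bsFldDivisorMonoidGp : Dᵒᵖ ⥤ CommMonCat.{w} := monoidGp C.bsFldMonoid

end TemperedFrobenioid

end Literature.AnabelianGeometry.EtaleTheta
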